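import Summits.HodgeConjecture.HodgeConjecture.Theses.TropicalWeilObstruction
import HarnessLib

/-!
# Crux `MumfordWeilShadow` (stmt-HodgeConjecture-18479), line `birth` — stub 3 `stub_extractEffective`:
# independent vectors in the `ℚ`-span of the effective cycle classes are witnessed by effective cycles

Route `HodgeConjecture/TropicalWeilObstruction`, crux `MumfordWeilShadow` (rank 3); registered skeleton
`Cruxes/MumfordWeilShadow/Lines/birth.lean` (`MumfordWeilShadow_of`: the Mumford–Weil fibre (XL) + the Weil Hodge triple (L) +
this extraction lemma (M)). This file closes the linear-algebra stub:

* **`stub_extractEffective`** (signature VERBATIM): if `m` `ℚ`-linearly independent vectors `v_k` of the real vector space of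
  Plücker coordinates `(Fin 4 → Fin 8) → (Fin 4 → Fin 8) → ℝ` lie in the `ℚ`-span of the classes `cyc Z` of the effective
  tropical `4`-cycles `Z` on `ℝ⁸/Qℤ⁸`, then there are `m` such cycles with `ℚ`-linearly independent classes.

Proof (exchange lemma): the set `R = range cyc` contains a `ℚ`-linearly independent subset `b` with the same span
(`exists_linearIndependent`); `b` is a basis of `W = span R`, the `v_k` are `m` independent vectors of `W`, so `m ≤ rank W = #b`
(`LinearIndependent.cardinal_lift_le_rank`), whence an embedding `Fin m ↪ b`; its image consists of `m` classes of effective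
cycles, linearly independent as a subfamily of `b`.

Nothing here is a case of the Hodge conjecture; no definition, no named fact, no sorry.
References: [Bourbaki, Algèbre II §7 no. 1 Thm. 2] (exchange / extracted basis); standard.
-/

noncomputable section

-- every declaration of this problem lives in `Summit.HodgeConjecture.HodgeConjecture.…` (summit = sub-problem)
set_option linter.dupNamespace false

open Literature.AlgebraicGeometry.Tropical

namespace Summit.HodgeConjecture.HodgeConjecture.Theorems.MumfordWeilShadow

universe u v

/-- **Extraction lemma** (any field `K`, any `K`-module `V`, any family `f : α → V`): `m` linearly independent vectors in the span
of `range f` are witnessed by `m` members of the family with linearly independent values. [folklore] -/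
theorem exists_linearIndependent_comp_of_mem_span {K : Type u} {V : Type v} [Field K] [AddCommGroup V] [Module K V]
    {α : Type*} (f : α → V) {m : ℕ} {v : Fin m → V} (hv : LinearIndependent K v)
    (hmem : ∀ k, v k ∈ Submodule.span K (Set.range f)) :
    ∃ c : Fin m → α, LinearIndependent K fun k ↦ f (c k) := by
  classical
  -- an independent subfamily `f ∘ a` with the same span
  obtain ⟨κ, a, _, hspan, hli⟩ := exists_linearIndependent' (K := K) f
  -- `v` restricted to `W = span (range (f ∘ a))` is independent, so `m ≤ rank W = #(range (f ∘ a))`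
  have hvW : ∀ k, v k ∈ Submodule.span K (Set.range (f ∘ a)) := fun k ↦ by rw [hspan]; exact hmem k
  have hv' : LinearIndependent K (fun k ↦ (⟨v k, hvW k⟩ : Submodule.span K (Set.range (f ∘ a)))) :=
    LinearIndependent.of_comp (Submodule.span K (Set.range (f ∘ a))).subtype hv
  have h1 := hv'.cardinal_lift_le_rank
  rw [rank_span hli, Cardinal.lift_mk_le'] at h1
  obtain ⟨e⟩ := h1
  -- the values `e k ∈ range (f ∘ a)` are independent; pick preimages
  have hrange : LinearIndependent K (fun x : Set.range (f ∘ a) ↦ (x : V)) :=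
    (hli.linearIndepOn_id).linearIndependent
  have hpre : ∀ k, ∃ i, (f ∘ a) i = (e k : V) := fun k ↦ (e k).2
  choose i hi using hpre
  refine ⟨fun k ↦ a (i k), ?_⟩
  have heq : (fun k ↦ f (a (i k))) = (fun x : Set.range (f ∘ a) ↦ (x : V)) ∘ e := funext fun k ↦ hi k
  rw [heq]
  exact hrange.comp e e.injective

/-- **Stub `stub_extractEffective` of crux `MumfordWeilShadow` (registered signature, verbatim):** `m` `ℚ`-independent vectors in
the `ℚ`-span of the effective tropical `4`-cycle classes of `ℝ⁸/Qℤ⁸` are witnessed by `m` effective cycles with `ℚ`-independent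
classes. [folklore] -/
theorem stub_extractEffective :
    ∀ (Q : Matrix (Fin (2 * 4)) (Fin (2 * 4)) ℝ) (m : ℕ)
      (v : Fin m → ((Fin 4 → Fin (2 * 4)) → (Fin 4 → Fin (2 * 4)) → ℝ)),
      LinearIndependent ℚ v →
      (∀ k, v k ∈ Submodule.span ℚ (Set.range
        (TropicalTorusCycle.cyc : TropicalTorusCycle (2 * 4) 4 Q →
          (Fin 4 → Fin (2 * 4)) → (Fin 4 → Fin (2 * 4)) → ℝ))) →
      ∃ c : Fin m → TropicalTorusCycle (2 * 4) 4 Q, LinearIndependent ℚ fun k => (c k).cyc :=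
  fun _ _ _ hv hmem ↦ exists_linearIndependent_comp_of_mem_span TropicalTorusCycle.cyc hv hmem

end Summit.HodgeConjecture.HodgeConjecture.Theorems.MumfordWeilShadow

end
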